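import Summits.CriticalPhenomena.PercolationContinuityZ3.Theorems.Transplant.FKConnectivityAllQSlackFourPoint
import Summits.CriticalPhenomena.PercolationContinuityZ3.Theorems.Transplant.FKConnectivityAllQCountReweightedFourPoint
import HarnessLib

/-!
# The slack four-point inequality on the 6-cycle holds for EVERY positive count weight — kernel certificate at the cell where the
# four-point inequality is FK-rigid (`fourPoint_c6_iff`: FourPoint ⟺ `h(2)h(4) ≤ h(3)²`)

Support file (`--supports stmt-CriticalPhenomena-4575`), FK sub-lane `prim-bschramm-fk-1` (gen 12); builds on p205010 (kernel theorem,
internal audit signed; external expert review pending).  Proof-only (two computable Boolean predicates, no `Prop` definitions), no named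
facts, no sorries; standard axioms (`decide +kernel` on level masses, as in `…CountReweightedFourPoint`).

On the 6-cycle `o–a–x–b–c–y–o` (`FourPointC6.c6`, parameters `½`, `o = 0, a = 1, c = 2, b = 3`) the level masses (×1/64) are
`x₆: 4h₂ + 4h₃ + h₄`, `x₇: h₂` (fk-1 g11) and — new — `g₃ = μ({c ↮ b} ∖ F): 2h₂ + 3h₃ + 5h₄ + 4h₅ + h₆`, `g₄ = μ({a ↮ b} ∖ F):
2h₂ + 5h₃ + 8h₄ + 5h₅ + h₆`; hence `4096·Z²·(g₃g₄ − x₆x₇) = (2h₂+3h₃+5h₄+4h₅+h₆)(2h₂+5h₃+8h₄+5h₅+h₆) − (4h₂+4h₃+h₄)h₂ ≥ 0` TERMWISE: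
**`slackFourPoint_c6`** — `SlackFourPointUnder (crMeasure c6.w h) o a c b` for every `h > 0`; with g11's `not_fourPoint_count_factorial`:
**`slackFourPoint_and_not_fourPoint_factorial`** (SFP strictly weaker than four-point, still ⇒ additive gluing for `|A| ≤ 2`).
Memo: bschramm/FROM-fk-1-g12-SLACK-FOURPOINT.md §1.2.
[cite: KozmaNitzan2024, Thm. 1, eq. (6) (pp. 7–8); Conj. 1 (p. 3)] [cite: Grimmett2006, §1.4 eq. (1.20) (p. 15); §3.9 (pp. 63–65)]
-/

/-! ### The 6-cycle: SFP holds for EVERY positive count weight where the four-point inequality is log-concavity at level 3 -/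

namespace Summit.CriticalPhenomena.PercolationContinuityZ3.Theorems

namespace FK

open MeasureTheory Set Literature.Probability.LatticeModels Literature.Probability.Percolation
open FourPointC6

namespace SlackC6

/-- `conf t ∈ {c ↮ b} ∖ F` as a Boolean (`o = 0, a = 1, c = 2, b = 3`). [folklore] -/
def pG3 (t : Finset (Fin 6)) : Bool :=
  !(c6.reachB t 2 3) && !((c6.reachB t 0 1 || c6.reachB t 0 2) && !(c6.reachB t 0 3))

/-- `conf t ∈ {a ↮ b} ∖ F` as a Boolean (`o = 0, a = 1, c = 2, b = 3`). [folklore] -/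
def pG4 (t : Finset (Fin 6)) : Bool :=
  !(c6.reachB t 1 3) && !((c6.reachB t 0 1 || c6.reachB t 0 2) && !(c6.reachB t 0 3))

/-- Level masses of `{c ↮ b} ∖ F` on the 6-cycle: `2, 3, 5, 4, 1` (×1/64) at `k = 2, …, 6`. [cite: Grimmett2006, §1.4 eq. (1.20) (p. 15)] -/
theorem levG3 : c6.levQ pG3 0 = 0 ∧ c6.levQ pG3 1 = 0 ∧ c6.levQ pG3 2 = 1 / 32 ∧ c6.levQ pG3 3 = 3 / 64 ∧ c6.levQ pG3 4 = 5 / 64 ∧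
    c6.levQ pG3 5 = 1 / 16 ∧ c6.levQ pG3 6 = 1 / 64 := by decide +kernel

/-- Level masses of `{a ↮ b} ∖ F` on the 6-cycle: `2, 5, 8, 5, 1` (×1/64) at `k = 2, …, 6`. [cite: Grimmett2006, §1.4 eq. (1.20) (p. 15)] -/
theorem levG4 : c6.levQ pG4 0 = 0 ∧ c6.levQ pG4 1 = 0 ∧ c6.levQ pG4 2 = 1 / 32 ∧ c6.levQ pG4 3 = 5 / 64 ∧ c6.levQ pG4 4 = 1 / 8 ∧
    c6.levQ pG4 5 = 5 / 64 ∧ c6.levQ pG4 6 = 1 / 64 := by decide +kernel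

noncomputable section

open scoped Classical

/-- `conf t ∈ {c ↮ b} ∖ F` iff `pG3`. [folklore] -/
theorem memG3 (t : Finset (Fin 6)) :
    c6.conf t ∈ ((openConn (2 : Fin 6) 3)ᶜ \ glueDefect (0 : Fin 6) 1 2 3 : Set (BondConfig (Fin 6))) ↔ pG3 t = true := by
  have e23 := c6.reachB_iff t 2 3
  have e01 := c6.reachB_iff t 0 1
  have e02 := c6.reachB_iff t 0 2
  have e03 := c6.reachB_iff t 0 3
  simp only [glueDefect, pG3, Set.mem_sdiff, Set.mem_compl_iff, Set.mem_union, mem_openConn_iff', ← e23, ← e01, ← e02, ← e03]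
  cases c6.reachB t 2 3 <;> cases c6.reachB t 0 1 <;> cases c6.reachB t 0 2 <;> cases c6.reachB t 0 3 <;> simp

/-- `conf t ∈ {a ↮ b} ∖ F` iff `pG4`. [folklore] -/
theorem memG4 (t : Finset (Fin 6)) :
    c6.conf t ∈ ((openConn (1 : Fin 6) 3)ᶜ \ glueDefect (0 : Fin 6) 1 2 3 : Set (BondConfig (Fin 6))) ↔ pG4 t = true := by
  have e13 := c6.reachB_iff t 1 3
  have e01 := c6.reachB_iff t 0 1
  have e02 := c6.reachB_iff t 0 2
  have e03 := c6.reachB_iff t 0 3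
  simp only [glueDefect, pG4, Set.mem_sdiff, Set.mem_compl_iff, Set.mem_union, mem_openConn_iff', ← e13, ← e01, ← e02, ← e03]
  cases c6.reachB t 1 3 <;> cases c6.reachB t 0 1 <;> cases c6.reachB t 0 2 <;> cases c6.reachB t 0 3 <;> simp

/-- `g₃·Z = (2h(2) + 3h(3) + 5h(4) + 4h(5) + h(6))/64`. [cite: Grimmett2006, §1.4 eq. (1.20) (p. 15)] -/
theorem sumG3 (h : ℕ → ℝ) : ∑ j ∈ Finset.range (c6.n + 1), (c6.levQ pG3 j : ℝ) * h j =
    h 2 / 32 + 3 * h 3 / 64 + 5 * h 4 / 64 + h 5 / 16 + h 6 / 64 := by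
  obtain ⟨e0, e1, e2, e3, e4, e5, e6⟩ := levG3
  simp only [show c6.n + 1 = 7 from rfl, Finset.sum_range_succ, Finset.sum_range_zero, e0, e1, e2, e3, e4, e5, e6]
  push_cast
  ring

/-- `g₄·Z = (2h(2) + 5h(3) + 8h(4) + 5h(5) + h(6))/64`. [cite: Grimmett2006, §1.4 eq. (1.20) (p. 15)] -/
theorem sumG4 (h : ℕ → ℝ) : ∑ j ∈ Finset.range (c6.n + 1), (c6.levQ pG4 j : ℝ) * h j =
    h 2 / 32 + 5 * h 3 / 64 + h 4 / 8 + 5 * h 5 / 64 + h 6 / 64 := by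
  obtain ⟨e0, e1, e2, e3, e4, e5, e6⟩ := levG4
  simp only [show c6.n + 1 = 7 from rfl, Finset.sum_range_succ, Finset.sum_range_zero, e0, e1, e2, e3, e4, e5, e6]
  push_cast
  ring

end

end SlackC6

noncomputable section

open scoped Classical
open SlackC6

/-- **The slack four-point inequality holds on the 6-cycle `o–a–x–b–c–y–o` under `μ_h ∝ P_½·h(k)` for EVERY positive count weight `h`**:
`4096·Z²·(g₃g₄ − x₆x₇) = (2h₂+3h₃+5h₄+4h₅+h₆)(2h₂+5h₃+8h₄+5h₅+h₆) − (4h₂+4h₃+h₄)h₂ ≥ 0` termwise — on the very cell where Kozma–Nitzan's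
four-point inequality is EQUIVALENT to `h(2)h(4) ≤ h(3)²` (`fourPoint_c6_iff`) and fails for `h = k!`.  Consistency witness for the node
`SlackFourPointCountPos` at the cell that makes the four-point inequality FK-rigid. [cite: KozmaNitzan2024, Thm. 1, eq. (6) (pp. 7–8)]
[cite: Grimmett2006, §1.4 eq. (1.20) (p. 15); §3.9 (pp. 63–65)] -/
theorem slackFourPoint_c6 {h : ℕ → ℝ} (hpos : ∀ k, 0 < h k) : SlackFourPointUnder (crMeasure c6.w h) (0 : Fin 6) 1 2 3 := by
  unfold SlackFourPointUnder
  rw [RCEval.cr_real_eq_levels_div valid hpos mem6, RCEval.cr_real_eq_levels_div valid hpos mem7,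
    RCEval.cr_real_eq_levels_div valid hpos memG3, RCEval.cr_real_eq_levels_div valid hpos memG4, sum6 h, sum7 h, sumG3 h, sumG4 h]
  have hZ : 0 < crPartition c6.w h := crPartition_pos c6.w hpos
  rw [div_mul_div_comm, div_mul_div_comm, div_le_div_iff_of_pos_right (mul_pos hZ hZ)]
  have h2 := hpos 2
  have h3 := hpos 3
  have h4 := hpos 4
  have h5 := hpos 5
  have h6 := hpos 6
  nlinarith [mul_pos h2 h3, mul_pos h2 h4, mul_pos h2 h5, mul_pos h2 h6, mul_pos h3 h3, mul_pos h3 h4, mul_pos h3 h5, mul_pos h3 h6,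
    mul_pos h4 h4, mul_pos h4 h5, mul_pos h4 h6, mul_pos h5 h5, mul_pos h5 h6, mul_pos h6 h6]

/-- **SFP holds but the four-point inequality fails** under `P_½·k!` on the 6-cycle: the slack four-point inequality is STRICTLY weaker
than Kozma–Nitzan's, yet still gives additive gluing for `|A| ≤ 2` (`additiveGluingUnder_pair_of_slackFourPoint`).
[cite: KozmaNitzan2024, Thm. 1 (p. 7)] [cite: Grimmett2006, §3.9 (pp. 63–65)] -/
theorem slackFourPoint_and_not_fourPoint_factorial :
    SlackFourPointUnder (crMeasure c6.w (fun k => (k.factorial : ℝ))) (0 : Fin 6) 1 2 3 ∧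
      ¬ FourPointUnder (crMeasure c6.w (fun k => (k.factorial : ℝ))) (0 : Fin 6) 1 2 3 :=
  ⟨slackFourPoint_c6 (fun k => by exact_mod_cast Nat.factorial_pos k), not_fourPoint_count_factorial⟩

end

end FK

end Summit.CriticalPhenomena.PercolationContinuityZ3.Theorems
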